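import Summits.QuantumAdvantage.QuantumAdvantage.Theorems.CharDialPlaneDivAscentD2
import HarnessLib

/-!
# PlaneDivAscent — PART E: structure of a hypothetical counterexample (many SPORADIC slabs)
(cell decomp-qadv, lens 6 «barrier-complement carving», g21 REV2.2; tree-ready, Prop-definition-free; needs Part D
(slabs, `lineCount`, `dvd_lineCount_of_mem_slabPer`, `isPeriod_of_lineCount_cast`) and Part C (`HL.hl_abstract`).)

If a plane-divisible `S ⊆ W` (`dim W = m`) has NO nonzero period then:
* `mem_perIn_of_slabPeriodic` — the hyperplane-lemma step in isolation: a `d ∈ W` that is a period of the slabs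
  of `S` on `p - 1` distinct affine hyperplanes `{cfun β = 1}` is a period of `S`; hence
* `card_periodicSlabs_le` — every `d ≠ 0` is a slab period on at most `p - 2` of the `p^m - 1` hyperplanes
  `{cfun β = 1}`; and by double counting
* ★ `card_sporadicSlabs_ge` — `p^m - 1 ≤ (p - 1) · #{β ≠ 0 : the slab on {cfun β = 1} has no nonzero period}`:
  at least a `1/(p-1)` fraction of the hyperplanes avoiding `0` (and, translating `S`, avoiding any fixed point)
  carry a SPORADIC slab — a nonempty plane-divisible set one dimension down without period (`exists_sporadicSlab`).
At `m = 4`, `p = 5` (census K44-general): a witness `S ⊆ 𝔽₅⁴` has `≥ 156` of its `624` slabs `{β = 1}` in the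
finite list of sporadic plane-divisible subsets of `𝔽₅³`, and every direction is a slab period on `≤ 3` of the
`124` hyperplanes `{β = 1}` parallel to it — symmetry-free pruning constraints for the instance.
-/

set_option autoImplicit false

namespace Summit.QuantumAdvantage.AdviceFreeQNC0.PlaneDiv

open Finset Module

section Sporadic

variable {p : ℕ} [Fact p.Prime] {n : ℕ}

open Classical in
/-- SPORADIC-SLAB BOUND.  A plane-divisible `S ⊆ W` (`dim W = m`) without nonzero period has at least
`(p^m - 1)/(p - 1)` coefficient vectors `β ≠ 0` whose slab `S ∩ {cfun β = 1}` has no nonzero period: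
`p^m - 1 ≤ (p - 1) · #{β ≠ 0 : slabPer β = 0}`. -/
theorem card_sporadicSlabs_ge {W : Submodule (ZMod p) (Fin n → ZMod p)}
    {S : Finset (Fin n → ZMod p)} (hSW : ∀ x ∈ S, x ∈ W)
    (hdiv : ∀ x ∈ W, ∀ a ∈ W, ∀ b ∈ W, p ∣ planeCount S x a b) (hnp : ∀ d ∈ perIn W S, d = 0) :
    p ^ finrank (ZMod p) W - 1 ≤ (p - 1) *
      ((Finset.univ.erase (0 : Fin (finrank (ZMod p) W) → ZMod p)).filter
        fun β => ∀ d ∈ slabPer W S β, d = 0).card := by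
  classical
  set m := finrank (ZMod p) W with hm
  set B : Finset (Fin m → ZMod p) := Finset.univ.erase 0 with hB
  have hBmem : ∀ β ∈ B, β ≠ 0 := fun β hβ => Finset.ne_of_mem_erase hβ
  have hp2 : 2 ≤ p := (Fact.out : p.Prime).two_le
  -- the finsets of nonzero slab periods
  set PF : (Fin m → ZMod p) → Finset (Fin n → ZMod p) := fun β =>
    (Finset.univ.filter fun d => d ∈ slabPer W S β).erase 0 with hPF
  have hPFmem : ∀ β d, d ∈ PF β ↔ d ≠ 0 ∧ d ∈ slabPer W S β := by
    intro β d
    simp only [hPF, Finset.mem_erase, Finset.mem_filter, Finset.mem_univ, true_and]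
  -- a slab with a nonzero period has at least `p - 1` of them
  have hcardP : ∀ β ∈ B, ¬ (∀ d ∈ slabPer W S β, d = 0) → p - 1 ≤ (PF β).card := by
    intro β _ hper
    have hrank : 1 ≤ finrank (ZMod p) (slabPer W S β) := by
      refine Submodule.one_le_finrank_iff.mpr ?_
      rw [Submodule.ne_bot_iff]
      by_contra hcon
      exact hper fun d hd => by
        by_contra hd0
        exact hcon ⟨d, hd, hd0⟩
    have hfull : (Finset.univ.filter fun d => d ∈ slabPer W S β).card
        = p ^ finrank (ZMod p) (slabPer W S β) := by
      have hc := Module.card_eq_pow_finrank (K := ZMod p) (V := slabPer W S β)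
      rw [ZMod.card] at hc
      rw [← hc]
      exact (Fintype.card_subtype _).symm
    have hge : p ≤ (Finset.univ.filter fun d => d ∈ slabPer W S β).card := by
      rw [hfull]
      calc p = p ^ 1 := (pow_one p).symm
        _ ≤ p ^ finrank (ZMod p) (slabPer W S β) := Nat.pow_le_pow_right (by omega) hrank
    have h0 : (0 : Fin n → ZMod p) ∈ (Finset.univ.filter fun d => d ∈ slabPer W S β) := by
      simp
    have := Finset.card_erase_of_mem h0
    simp only [hPF]
    omega
  -- double counting
  set N : (Fin n → ZMod p) → ℕ := fun d => (B.filter fun β => d ∈ PF β).card with hN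
  have hcount : ∑ β ∈ B, (PF β).card = ∑ d, N d := by
    have h1 : ∀ β ∈ B, (PF β).card = ∑ d, if d ∈ PF β then 1 else 0 := by
      intro β _
      rw [Finset.sum_boole, Finset.filter_univ_mem]
      simp
    rw [Finset.sum_congr rfl h1, Finset.sum_comm]
    refine Finset.sum_congr rfl fun d _ => ?_
    rw [hN, Finset.sum_boole]
    simp
  have hNW : ∀ d, N d ≠ 0 → d ∈ W ∧ d ≠ 0 := by
    intro d hd
    obtain ⟨β, hβ⟩ := Finset.card_pos.mp (Nat.pos_of_ne_zero hd)
    rw [Finset.mem_filter] at hβ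
    obtain ⟨hd0, hdP⟩ := (hPFmem β d).mp hβ.2
    exact ⟨slabPer_le W S β hdP, hd0⟩
  -- no `d` is a slab period on `p - 1` hyperplanes (else it would be a period, by the hyperplane lemma)
  have hNle : ∀ d, N d ≤ p - 2 := by
    intro d
    by_contra hcon
    have hd : p - 1 ≤ N d := by omega
    have hdW : d ∈ W ∧ d ≠ 0 := hNW d (by omega)
    obtain ⟨t, htsub, htcard⟩ := Finset.exists_subset_card_eq hd
    have htmem : ∀ β ∈ t, β ≠ 0 ∧ d ∈ slabPer W S β := by
      intro β hβ
      have := htsub hβ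
      rw [Finset.mem_filter] at this
      exact ⟨hBmem β this.1, ((hPFmem β d).mp this.2).2⟩
    have hct : Fintype.card t = p - 1 := by rw [Fintype.card_coe]; exact htcard
    set e : t ≃ Fin (p - 1) := Fintype.equivFinOfCardEq hct with he
    set φ : Fin (p - 1) → (W →ₗ[ZMod p] ZMod p) := fun i => cfun W (e.symm i).1 with hφ
    set g : W → ZMod p := fun w => (lineCount S d (w : Fin n → ZMod p) : ZMod p) with hg
    have hlines : ∀ y v : W, ∑ t : ZMod p, g (y + t • v) = 0 := by
      intro y v
      simp only [hg, Submodule.coe_add, Submodule.coe_smul]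
      rw [← Nat.cast_sum, sum_lineCount_eq_planeCount, ZMod.natCast_eq_zero_iff]
      exact hdiv _ y.2 _ v.2 d hdW.1
    have hφ0 : ∀ i, φ i ≠ 0 := fun i => cfun_ne_zero W (htmem _ (e.symm i).2).1
    have hprop : ∀ i j, i ≠ j → ∀ l : ZMod p, ¬ (φ j = l • φ i ∧ (1 : ZMod p) = l * 1) := by
      intro i j hij l hl
      obtain ⟨h1, h2⟩ := hl
      rw [mul_one] at h2
      rw [← h2, one_smul] at h1
      have hb : (e.symm j).1 = (e.symm i).1 := cfun_injective W h1
      have : e.symm j = e.symm i := Subtype.ext hb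
      exact hij (e.symm.injective this).symm
    have hvan : ∀ i, ∀ x : W, φ i x = 1 → g x = 0 := by
      intro i x hx
      simp only [hg]
      rw [ZMod.natCast_eq_zero_iff]
      exact dvd_lineCount_of_mem_slabPer (htmem _ (e.symm i).2).1 (htmem _ (e.symm i).2).2 x hx
    have hzero : ∀ x : W, g x = 0 :=
      HL.hl_abstract W g hlines φ (fun _ => 1) hφ0 hprop hvan
    have hper : d ∈ perIn W S :=
      mem_perIn.mpr ⟨hdW.1, isPeriod_of_lineCount_cast hSW hdW.1 fun y hy => hzero ⟨y, hy⟩⟩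
    exact hdW.2 (hnp d hper)
  -- cardinalities
  have hcardB : B.card = p ^ m - 1 := by
    rw [hB, Finset.card_erase_of_mem (Finset.mem_univ _), Finset.card_univ, Fintype.card_fun,
      ZMod.card, Fintype.card_fin]
  have hcardW : ((Finset.univ.filter fun d : Fin n → ZMod p => d ∈ W).erase 0).card = p ^ m - 1 := by
    have hfull : (Finset.univ.filter fun d : Fin n → ZMod p => d ∈ W).card = p ^ m := by
      have hc := Module.card_eq_pow_finrank (K := ZMod p) (V := W)
      rw [ZMod.card] at hc
      rw [hm, ← hc]
      exact (Fintype.card_subtype _).symm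
    have h0 : (0 : Fin n → ZMod p) ∈ (Finset.univ.filter fun d : Fin n → ZMod p => d ∈ W) := by simp
    rw [Finset.card_erase_of_mem h0, hfull]
  -- upper bound on the incidence count
  have hle : ∑ d, N d ≤ ∑ d : Fin n → ZMod p, (if d ∈ W ∧ d ≠ 0 then p - 2 else 0) := by
    apply Finset.sum_le_sum
    intro d _
    by_cases hNd : N d = 0
    · rw [hNd]; exact Nat.zero_le _
    · rw [if_pos (hNW d hNd)]
      exact hNle d
  have hsum : ∑ d : Fin n → ZMod p, (if d ∈ W ∧ d ≠ 0 then p - 2 else 0)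
      = ((Finset.univ.filter fun d : Fin n → ZMod p => d ∈ W).erase 0).card * (p - 2) := by
    rw [← Finset.sum_filter, Finset.sum_const, smul_eq_mul]
    congr 2
    ext d
    simp [Finset.mem_erase, and_comm]
  rw [hsum, hcardW] at hle
  -- lower bound on the incidence count: the periodic slabs
  set Per := B.filter fun β => ¬ ∀ d ∈ slabPer W S β, d = 0 with hPer
  set Spor := B.filter fun β => ∀ d ∈ slabPer W S β, d = 0 with hSpor
  have hsplit : Spor.card + Per.card = B.card := by
    rw [hSpor, hPer]
    exact Finset.card_filter_add_card_filter_not _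
  have hlow : Per.card * (p - 1) ≤ ∑ β ∈ B, (PF β).card := by
    have h1 : Per.card * (p - 1) ≤ ∑ β ∈ Per, (PF β).card := by
      have := Finset.card_nsmul_le_sum Per (fun β => (PF β).card) (p - 1) (by
        intro β hβ
        rw [hPer, Finset.mem_filter] at hβ
        exact hcardP β hβ.1 hβ.2)
      simpa using this
    exact le_trans h1 (Finset.sum_le_sum_of_subset (Finset.filter_subset _ _))
  rw [hcount] at hlow
  -- arithmetic
  have key : Per.card * (p - 1) ≤ (p ^ m - 1) * (p - 2) := le_trans hlow hle
  rw [hcardB] at hsplit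
  show p ^ m - 1 ≤ (p - 1) * Spor.card
  have e3 : (p - 1) * (p ^ m - 1) = (p ^ m - 1) * (p - 2) + (p ^ m - 1) := by
    have : p - 1 = (p - 2) + 1 := by omega
    rw [this, add_mul, one_mul, mul_comm]
  have e1 : (p - 1) * Spor.card + (p - 1) * Per.card = (p - 1) * (p ^ m - 1) := by
    rw [← mul_add, hsplit]
  generalize hX : (p - 1) * Spor.card = X at e1
  generalize hY : (p - 1) * Per.card = Y at e1
  generalize hZ : (p - 1) * (p ^ m - 1) = Z at e1 e3
  generalize hU : (p ^ m - 1) * (p - 2) = U at key e3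
  have hY' : Y = Per.card * (p - 1) := by rw [← hY, mul_comm]
  omega

open Classical in
/-- The same bound read as a fraction: at least a `1/(p-1)` fraction of the `p^m - 1` affine hyperplanes
`{cfun β = 1}` carry a slab without nonzero period; in particular (if `m ≥ 1`) some slab is sporadic or
empty-periodless — stated here simply as the existence of such a `β ≠ 0` when `p ^ m > 1`. -/
theorem exists_sporadicSlab {W : Submodule (ZMod p) (Fin n → ZMod p)}
    {S : Finset (Fin n → ZMod p)} (hSW : ∀ x ∈ S, x ∈ W)
    (hdiv : ∀ x ∈ W, ∀ a ∈ W, ∀ b ∈ W, p ∣ planeCount S x a b) (hnp : ∀ d ∈ perIn W S, d = 0)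
    (hm : 1 ≤ finrank (ZMod p) W) :
    ∃ β : Fin (finrank (ZMod p) W) → ZMod p, β ≠ 0 ∧ ∀ d ∈ slabPer W S β, d = 0 := by
  classical
  have h := card_sporadicSlabs_ge hSW hdiv hnp
  have hp2 : 2 ≤ p := (Fact.out : p.Prime).two_le
  have hpos : 0 < p ^ finrank (ZMod p) W - 1 := by
    have : p ≤ p ^ finrank (ZMod p) W := by
      calc p = p ^ 1 := (pow_one p).symm
        _ ≤ _ := Nat.pow_le_pow_right (by omega) hm
    omega
  have hne : ((Finset.univ.erase (0 : Fin (finrank (ZMod p) W) → ZMod p)).filter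
      fun β => ∀ d ∈ slabPer W S β, d = 0).Nonempty := by
    rw [← Finset.card_pos]
    by_contra h0
    have : ((Finset.univ.erase (0 : Fin (finrank (ZMod p) W) → ZMod p)).filter
      fun β => ∀ d ∈ slabPer W S β, d = 0).card = 0 := by omega
    rw [this, mul_zero] at h
    omega
  obtain ⟨β, hβ⟩ := hne
  rw [Finset.mem_filter] at hβ
  exact ⟨β, Finset.ne_of_mem_erase hβ.1, hβ.2⟩

/-- INSTRUMENT (the hyperplane-lemma step in isolation).  If `d ∈ W`, `d ≠ 0`, is a period of the slabs of
`S` on `p - 1` distinct affine hyperplanes `{cfun β = 1}` (`β ∈ t`, `|t| = p - 1`, all `β ≠ 0`), then `d` is a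
period of `S` in `W`.  Contrapositive for a set without period: every `d ≠ 0` is a slab period on at most
`p - 2` of the hyperplanes `{cfun β = 1}`. -/
theorem mem_perIn_of_slabPeriodic {W : Submodule (ZMod p) (Fin n → ZMod p)}
    {S : Finset (Fin n → ZMod p)} (hSW : ∀ x ∈ S, x ∈ W)
    (hdiv : ∀ x ∈ W, ∀ a ∈ W, ∀ b ∈ W, p ∣ planeCount S x a b) {d : Fin n → ZMod p} (hdW : d ∈ W)
    (t : Finset (Fin (finrank (ZMod p) W) → ZMod p)) (htcard : t.card = p - 1)
    (htmem : ∀ β ∈ t, β ≠ 0 ∧ d ∈ slabPer W S β) : d ∈ perIn W S := by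
  classical
  have hct : Fintype.card t = p - 1 := by rw [Fintype.card_coe]; exact htcard
  set e : t ≃ Fin (p - 1) := Fintype.equivFinOfCardEq hct with he
  set φ : Fin (p - 1) → (W →ₗ[ZMod p] ZMod p) := fun i => cfun W (e.symm i).1 with hφ
  set g : W → ZMod p := fun w => (lineCount S d (w : Fin n → ZMod p) : ZMod p) with hg
  have hlines : ∀ y v : W, ∑ t : ZMod p, g (y + t • v) = 0 := by
    intro y v
    simp only [hg, Submodule.coe_add, Submodule.coe_smul]
    rw [← Nat.cast_sum, sum_lineCount_eq_planeCount, ZMod.natCast_eq_zero_iff]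
    exact hdiv _ y.2 _ v.2 d hdW
  have hφ0 : ∀ i, φ i ≠ 0 := fun i => cfun_ne_zero W (htmem _ (e.symm i).2).1
  have hprop : ∀ i j, i ≠ j → ∀ l : ZMod p, ¬ (φ j = l • φ i ∧ (1 : ZMod p) = l * 1) := by
    intro i j hij l hl
    obtain ⟨h1, h2⟩ := hl
    rw [mul_one] at h2
    rw [← h2, one_smul] at h1
    have hb : (e.symm j).1 = (e.symm i).1 := cfun_injective W h1
    have : e.symm j = e.symm i := Subtype.ext hb
    exact hij (e.symm.injective this).symm
  have hvan : ∀ i, ∀ x : W, φ i x = 1 → g x = 0 := by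
    intro i x hx
    simp only [hg]
    rw [ZMod.natCast_eq_zero_iff]
    exact dvd_lineCount_of_mem_slabPer (htmem _ (e.symm i).2).1 (htmem _ (e.symm i).2).2 x hx
  have hzero : ∀ x : W, g x = 0 :=
    HL.hl_abstract W g hlines φ (fun _ => 1) hφ0 hprop hvan
  exact mem_perIn.mpr ⟨hdW, isPeriod_of_lineCount_cast hSW hdW fun y hy => hzero ⟨y, hy⟩⟩

open Classical in
/-- INSTRUMENT, counted form: if `S ⊆ W` is plane-divisible with no nonzero period, then every `d ≠ 0` lies
in the slab period space of at most `p - 2` of the hyperplanes `{cfun β = 1}`, `β ≠ 0`. -/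
theorem card_periodicSlabs_le {W : Submodule (ZMod p) (Fin n → ZMod p)}
    {S : Finset (Fin n → ZMod p)} (hSW : ∀ x ∈ S, x ∈ W)
    (hdiv : ∀ x ∈ W, ∀ a ∈ W, ∀ b ∈ W, p ∣ planeCount S x a b) (hnp : ∀ d ∈ perIn W S, d = 0)
    {d : Fin n → ZMod p} (hd0 : d ≠ 0) :
    ((Finset.univ.erase (0 : Fin (finrank (ZMod p) W) → ZMod p)).filter
      fun β => d ∈ slabPer W S β).card ≤ p - 2 := by
  classical
  by_contra hcon
  have hge : p - 1 ≤ ((Finset.univ.erase (0 : Fin (finrank (ZMod p) W) → ZMod p)).filter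
      fun β => d ∈ slabPer W S β).card := by omega
  obtain ⟨t, htsub, htcard⟩ := Finset.exists_subset_card_eq hge
  have htmem : ∀ β ∈ t, β ≠ 0 ∧ d ∈ slabPer W S β := by
    intro β hβ
    have := htsub hβ
    rw [Finset.mem_filter] at this
    exact ⟨Finset.ne_of_mem_erase this.1, this.2⟩
  have hdW : d ∈ W := by
    have hp2 : 2 ≤ p := (Fact.out : p.Prime).two_le
    have hne : t.Nonempty := by rw [← Finset.card_pos]; omega
    obtain ⟨β, hβ⟩ := hne
    exact slabPer_le W S β (htmem β hβ).2
  exact hd0 (hnp d (mem_perIn_of_slabPeriodic hSW hdiv hdW t htcard htmem))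

end Sporadic


end Summit.QuantumAdvantage.AdviceFreeQNC0.PlaneDiv
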